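import Mathlib.RingTheory.Derivation.Basic
import Mathlib.RingTheory.Length
import Mathlib.Algebra.CharP.Lemmas
import Mathlib.Algebra.Ring.Subring.Basic
import HarnessLib

/-!
# Crux `Steer` (stmt-ResolutionOfSingularities-16345), chain W4.1: the INTRINSIC JACOBIAN CONTENT ideal
# `jacAbs` of an element, its Milnor-type length `muAbs`, cleaning-invariance (J1) and the strict-transform
# law for derivations (J2a) — Theses-free helper, vendored from res-L0-w41-idea-1's sketch

OURS (campaign `res-hironaka`, rung L ★L-G4, slot W4.1, chain W4.1; seat `res-type-022` on ORDER α of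
`res-L0-w41-plan-1` 2026-08-27T05:54:33Z = res-L0-w41-idea-1's «offer α» 04:59:48Z; replaces the role of no
printed item; NOT a statement of the manuscript under review; AI review is weaker than expert review). This file
vendors VERBATIM (bodies unchanged; only the namespace and this header are new) the sorry-free §8
`section Intrinsic` (l.1306–1364) of `L/res-L0-w41-idea-1/Sketch-idea-1.lean` v5 (sha16 651c7cf89f1c20d6), card
`frobenius-closing-imperfect` — the engine law of K(3)ᶠⁱⁿ («μ⁺ = colength of `jacAbs`, monotone under steps»)
banked in the kernel:

* `JacAbs.jacAbs S f` — the (absolute) Jacobian content ideal `{δ f : δ ∈ Der_ℤ(S, S)} · S`;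
* `JacAbs.muAbs S f` — the length of `S ⧸ jacAbs S f` (an `ℕ∞`);
* `JacAbs.derivation_apply_pow_char` — derivations kill `p`-th powers in characteristic `p`;
* `JacAbs.jacAbs_add_pow_char` — **(J1) cleaning-invariance** `jacAbs (f + g ^ p) = jacAbs f`;
* `JacAbs.derivation_subring_apply_pow` — the same for derivations of a subring of a field of characteristic `p`;
* `JacAbs.derivation_strictTransform` — **(J2a)** across a strict-transform step `f = x ^ p f₁ + g ^ p` inside a
  subring `S₁` of a field, `δ₁ f = x ^ p · δ₁ f₁` for EVERY `δ₁ ∈ Der(S₁)`.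

NOT vendored here: (J3) `JacobianCriterionFormal` (Nagata's Jacobian criterion, Matsumura §30) — a named
Literature fact, to be filed separately once idea-1's `serD` / `jacD` / `IsolD` vocabulary is in the tree.
[folklore]
-/

-- `Summit.<S>.<S>.…` duplicates the summit name by design (single-problem summit).
set_option linter.dupNamespace false

namespace Summit.ResolutionOfSingularities.ResolutionOfSingularities.Theorems.SwitchingDichotomy

namespace JacAbs

variable (S : Type) [CommRing S]

/-- **`jacAbs S f`** — the (absolute) Jacobian content ideal `{δ f : δ ∈ Der_ℤ(S, S)}` = the image of
`Hom_S(Ω_S, S) → S`, `ℓ ↦ ℓ(df)`.  Over a perfect ground field of characteristic `p` every derivation is automatically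
linear over it. OURS (res-L0-w41-idea-1, Sketch-idea-1 v5 §8, verbatim). [folklore] -/
def jacAbs (f : S) : Ideal S :=
  Ideal.span (Set.range fun δ : Derivation ℤ S S => δ f)

/-- **`muAbs S f`** — the intrinsic Milnor-type number: the length of `S ⧸ jacAbs S f` (`⊤` when not of finite length;
for a local `S`: finite iff `jacAbs S f` is primary to the maximal ideal or the unit ideal). OURS (res-L0-w41-idea-1,
Sketch-idea-1 v5 §8, verbatim). [folklore] -/
noncomputable def muAbs (f : S) : ℕ∞ :=
  Module.length S (S ⧸ jacAbs S f)

/-- In characteristic `p` every derivation kills `p`-th powers. (res-L0-w41-idea-1, Sketch-idea-1 v5 §8, verbatim;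
the `R = ℤ` case of the tree's `CossartPiltant200819.OrderAtClosedPoint.derivation_apply_pow_char`, restated here to
keep this helper's imports minimal.) [folklore] -/
theorem derivation_apply_pow_char (p : ℕ) [CharP S p] (δ : Derivation ℤ S S) (g : S) : δ (g ^ p) = 0 := by
  rw [Derivation.leibniz_pow, nsmul_eq_mul, CharP.cast_eq_zero S p, zero_mul]

/-- **(J1) cleaning-invariance**: `jacAbs (f + g^p) = jacAbs f` in characteristic `p`. OURS (res-L0-w41-idea-1,
Sketch-idea-1 v5 §8, verbatim). [folklore] -/
theorem jacAbs_add_pow_char (p : ℕ) [CharP S p] (f g : S) : jacAbs S (f + g ^ p) = jacAbs S f := by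
  unfold jacAbs
  congr 1
  ext x
  simp only [Set.mem_range, map_add, derivation_apply_pow_char S p, add_zero]

variable {K : Type} [Field K]

/-- Derivations of a subring of a characteristic-`p` field kill `p`-th powers. (res-L0-w41-idea-1, Sketch-idea-1 v5
§8, verbatim.) [folklore] -/
theorem derivation_subring_apply_pow (p : ℕ) [CharP K p] (S₁ : Subring K) (δ₁ : Derivation ℤ S₁ S₁) (y : S₁) :
    δ₁ (y ^ p) = 0 := by
  apply Subtype.ext
  rw [Derivation.leibniz_pow, nsmul_eq_mul]
  simp only [smul_eq_mul, Subring.coe_mul, Subring.coe_natCast, CharP.cast_eq_zero K p, zero_mul,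
    Subring.coe_zero]

/-- **(J2a) the strict-transform law for EVERY derivation of the successor ring**: if `f = x^p f₁ + g^p` inside
`S₁` then `δ₁ f = x^p · δ₁ f₁` for every `δ₁ ∈ Der(S₁)`; hence `jacAbs_{S₁}(f₁) = x^{-p} · {δ₁ f}`.  (The
value-budget version along a valuation is the landed `Theorems.SteerRankThinness.jacobianStepLaw` /
`jacobianValueBudget`, p493200.) OURS (res-L0-w41-idea-1, Sketch-idea-1 v5 §8, verbatim). [folklore] -/
theorem derivation_strictTransform (p : ℕ) [CharP K p] (S₁ : Subring K) (δ₁ : Derivation ℤ S₁ S₁)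
    (x f₁ g : S₁) :
    ((δ₁ (x ^ p * f₁ + g ^ p) : S₁) : K) = (x : K) ^ p * ((δ₁ f₁ : S₁) : K) := by
  rw [map_add, derivation_subring_apply_pow p S₁ δ₁ g, add_zero, Derivation.leibniz,
    derivation_subring_apply_pow p S₁ δ₁ x]
  simp only [smul_eq_mul, mul_zero, add_zero, Subring.coe_mul, Subring.coe_pow]

end JacAbs

end Summit.ResolutionOfSingularities.ResolutionOfSingularities.Theorems.SwitchingDichotomy
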